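import Literature.MathematicalPhysics.QuantumLattice.FreeFermionSectorEnergyDeviation
import Literature.MathematicalPhysics.QuantumLattice.PairFieldMomentum

/-!
# Crux `WindowInfraredBound` (stmt-HubbardSuperconductivity-1089) — the free point `U = 0`, stub S4a:
# pair modes through a sharp Fermi level are orthogonal (Pythagoras)

Support of the R4 calibration `FreeWindowBoundAllGroundStates` (line `free-window-calibration`, skeleton
`Cruxes/WindowInfraredBound/Lines/free_window_calibration.lean`). For the Bloch pair modes
`B_m(k) = c_{(m−k)↓} c_{k↑} = momentumAnnihilation (m - k) 1 * momentumAnnihilation k 0` of the fermionic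
torus `(ℤ/Lℤ)²` and a vector `ψ` which is SHARP on a finite set `K` of momenta (`n_{k↑}ψ = ψ` or
`n_{(m−k)↓}ψ = ψ` for each `k ∈ K`):

* `fom_star_mulVec_dotProduct_mulVec_eq_zero` — the selection rule `⟨B'ψ, Bψ⟩ = 0` whenever a Hermitian
  `P` fixes `ψ`, commutes with `B'` and kills `B` (`P B = 0`);
* `fom_pairMode_orthogonal` — `⟨B_m(k')ψ, B_m(k)ψ⟩ = 0` for `k ≠ k'`, `k` sharp (insert the sharp
  occupation number, commute it through `B_m(k')`, `n c = 0`);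
* `fom_re_pairMode_mem_Icc` — `0 ≤ ‖B_m(k)ψ‖² ≤ ‖ψ‖²` (`c†c = n` is an orthogonal projection, twice);
* `stub_freeOrthogonalModeSum` (registered stub of the skeleton) —
  `‖Σ_{k∈K} A(k) B_m(k) ψ‖² = Σ_{k∈K} |A(k)|² ‖B_m(k)ψ‖² ≤ a · #K · ‖ψ‖²` when `|A(k)|² ≤ a` on `K`.

Sources: J. Bardeen, L. N. Cooper, J. R. Schrieffer, Phys. Rev. 108 (1957) 1175, §II (pair correlations
of a sharp Fermi sea are diagonal in `k`); C. N. Yang, Rev. Mod. Phys. 34 (1962) 694, §3. Folklore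
finite-dimensional statements over the tree's definitions; no definition and no named fact is introduced.
-/

noncomputable section

set_option linter.dupNamespace false

namespace Summit.HubbardSuperconductivity.HubbardSuperconductivity.Theorems.WindowInfraredBound

open Matrix Finset
open Literature.Probability.LatticeModels Literature.MathematicalPhysics.QuantumLattice
open scoped ComplexOrder ComplexConjugate

section OrthogonalModes

variable {L : ℕ} [NeZero L]

/-- **Selection rule.** If a Hermitian matrix `P` fixes `ψ` (`Pψ = ψ`), commutes with `B'` and
annihilates `B` from the left (`P B = 0`), then `⟨B'ψ, Bψ⟩ = ⟨P B'ψ, Bψ⟩ = ⟨ψ, B'ᴴ (P B) ψ⟩ = 0`.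
Bardeen–Cooper–Schrieffer, Phys. Rev. 108 (1957) 1175, §II. [folklore] -/
theorem fom_star_mulVec_dotProduct_mulVec_eq_zero {n : Type*} [Fintype n] {P B B' : Matrix n n ℂ}
    {ψ : n → ℂ} (hP : Pᴴ = P) (hPψ : P *ᵥ ψ = ψ) (hcomm : P * B' = B' * P) (hPB : P * B = 0) :
    star (B' *ᵥ ψ) ⬝ᵥ (B *ᵥ ψ) = 0 := by
  calc star (B' *ᵥ ψ) ⬝ᵥ (B *ᵥ ψ) = star ((P * B') *ᵥ ψ) ⬝ᵥ (B *ᵥ ψ) := by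
        rw [hcomm, ← mulVec_mulVec, hPψ]
    _ = star ψ ⬝ᵥ (((P * B')ᴴ * B) *ᵥ ψ) := star_mulVec_dotProduct_mulVec _ _ _
    _ = 0 := by
        rw [conjTranspose_mul, hP, Matrix.mul_assoc, hPB, Matrix.mul_zero, Matrix.zero_mulVec,
          dotProduct_zero]

/-- **Pair modes through a sharp level are orthogonal.** For `k ≠ k'` and `ψ` with `n_{k↑}ψ = ψ` or
`n_{(m−k)↓}ψ = ψ`: `⟨c_{(m−k')↓}c_{k'↑} ψ, c_{(m−k)↓}c_{k↑} ψ⟩ = 0` (the sharp occupation number commutes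
with both factors of the `k'`-mode and kills the `k`-mode, `n_{kσ} c_{kσ} = 0`).
Bardeen–Cooper–Schrieffer, Phys. Rev. 108 (1957) 1175, §II. [folklore] -/
theorem fom_pairMode_orthogonal (m k k' : TorusSite 2 L) (hkk' : k ≠ k')
    (ψ : Fock (Orb (FermionTorus 2 L)))
    (hk : momentumNumber k 0 *ᵥ ψ = ψ ∨ momentumNumber (m - k) 1 *ᵥ ψ = ψ) :
    star ((momentumAnnihilation (m - k') 1 * momentumAnnihilation k' 0) *ᵥ ψ) ⬝ᵥ
      ((momentumAnnihilation (m - k) 1 * momentumAnnihilation k 0) *ᵥ ψ) = 0 := by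
  rcases hk with h | h
  · -- `P = n_{k↑}`
    refine fom_star_mulVec_dotProduct_mulVec_eq_zero (momentumNumber_conjTranspose k 0) h ?_ ?_
    · rw [← Matrix.mul_assoc,
        momentumNumber_mul_momentumAnnihilation_of_ne (fun h' => absurd h'.2 (by decide)),
        Matrix.mul_assoc, momentumNumber_mul_momentumAnnihilation_of_ne (fun h' => hkk' h'.1),
        ← Matrix.mul_assoc]
    · rw [← Matrix.mul_assoc,
        momentumNumber_mul_momentumAnnihilation_of_ne (fun h' => absurd h'.2 (by decide)),
        Matrix.mul_assoc, momentumNumber_mul_momentumAnnihilation_self, Matrix.mul_zero]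
  · -- `P = n_{(m-k)↓}`
    refine fom_star_mulVec_dotProduct_mulVec_eq_zero (momentumNumber_conjTranspose (m - k) 1) h
      ?_ ?_
    · rw [← Matrix.mul_assoc,
        momentumNumber_mul_momentumAnnihilation_of_ne (fun h' => hkk' (sub_right_injective h'.1)),
        Matrix.mul_assoc,
        momentumNumber_mul_momentumAnnihilation_of_ne (fun h' => absurd h'.2 (by decide)),
        ← Matrix.mul_assoc]
    · rw [← Matrix.mul_assoc, momentumNumber_mul_momentumAnnihilation_self, Matrix.zero_mul]

/-- `‖c_{pσ} w‖² = ⟨w, n_{pσ} w⟩` (`n_{pσ} = c†_{pσ} c_{pσ}`). [folklore] -/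
theorem fom_star_momentumAnnihilation_mulVec_dotProduct (p : TorusSite 2 L) (σ : Fin 2)
    (w : Fock (Orb (FermionTorus 2 L))) :
    star (momentumAnnihilation p σ *ᵥ w) ⬝ᵥ (momentumAnnihilation p σ *ᵥ w) =
      star w ⬝ᵥ (momentumNumber p σ *ᵥ w) :=
  star_mulVec_dotProduct_mulVec _ _ _

/-- **`0 ≤ ‖c_{(m−k)↓} c_{k↑} ψ‖² ≤ ‖ψ‖²`**: `‖c_{pσ} w‖² = ⟨w, n_{pσ} w⟩ ∈ [0, ‖w‖²]` (the occupation
number is an orthogonal projection), applied twice. [folklore] -/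
theorem fom_re_pairMode_mem_Icc (m k : TorusSite 2 L) (ψ : Fock (Orb (FermionTorus 2 L))) :
    (star ((momentumAnnihilation (m - k) 1 * momentumAnnihilation k 0) *ᵥ ψ) ⬝ᵥ
        ((momentumAnnihilation (m - k) 1 * momentumAnnihilation k 0) *ᵥ ψ)).re ∈
      Set.Icc 0 (star ψ ⬝ᵥ ψ).re := by
  rw [← mulVec_mulVec, fom_star_momentumAnnihilation_mulVec_dotProduct]
  refine ⟨(re_expect_momentumNumber_mem_Icc _ _ _).1,
    (re_expect_momentumNumber_mem_Icc _ _ _).2.trans ?_⟩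
  rw [fom_star_momentumAnnihilation_mulVec_dotProduct]
  exact (re_expect_momentumNumber_mem_Icc _ _ _).2

end OrthogonalModes

/-- **Stub S4a — pair modes through a sharp level are orthogonal (Pythagoras).** For the pair modes
`B_m(k) = c_{(m−k)↓} c_{k↑}` and a finite set `K` of momenta each of which has `n_{k↑}ψ = ψ` or
`n_{(m−k)↓}ψ = ψ`: the vectors `B_m(k)ψ`, `k ∈ K`, are pairwise orthogonal (insert the sharp occupation,
commute it to the other mode, `n c = 0`), and `‖B_m(k)ψ‖ ≤ ‖ψ‖`, so
`‖Σ_{k∈K} A(k) B_m(k) ψ‖² ≤ a · #K · ‖ψ‖²` when `|A(k)|² ≤ a`. Bardeen–Cooper–Schrieffer (1957) §II. [folklore] -/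
theorem stub_freeOrthogonalModeSum : ∀ (L : ℕ) [NeZero L] (m : TorusSite 2 L) (A : TorusSite 2 L → ℂ)
    (a : ℝ) (K : Finset (TorusSite 2 L)) (ψ : Fock (Orb (FermionTorus 2 L))),
    (∀ k ∈ K, ‖A k‖ ^ 2 ≤ a) →
    (∀ k ∈ K, momentumNumber k 0 *ᵥ ψ = ψ ∨ momentumNumber (m - k) 1 *ᵥ ψ = ψ) →
    (star ((∑ k ∈ K, A k • (momentumAnnihilation (m - k) 1 * momentumAnnihilation k 0)) *ᵥ ψ) ⬝ᵥ
        ((∑ k ∈ K, A k • (momentumAnnihilation (m - k) 1 * momentumAnnihilation k 0)) *ᵥ ψ)).re ≤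
      a * K.card * (star ψ ⬝ᵥ ψ).re := by
  intro L _ m A a K ψ hA hK
  -- the mode vectors `w k = B_m(k) ψ`
  set w : TorusSite 2 L → Fock (Orb (FermionTorus 2 L)) :=
    fun k => (momentumAnnihilation (m - k) 1 * momentumAnnihilation k 0) *ᵥ ψ
  have hv : (∑ k ∈ K, A k • (momentumAnnihilation (m - k) 1 * momentumAnnihilation k 0)) *ᵥ ψ =
      ∑ k ∈ K, A k • w k := by
    rw [Matrix.sum_mulVec]
    exact Finset.sum_congr rfl fun k _ => Matrix.smul_mulVec _ _ _
  -- off-diagonal Gram entries vanish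
  have hoff : ∀ k' ∈ K, ∀ k ∈ K, k ≠ k' → star (w k') ⬝ᵥ (w k) = 0 :=
    fun k' _ k hk hne => fom_pairMode_orthogonal m k k' hne ψ (hK k hk)
  -- Pythagoras
  have hexp : star (∑ k ∈ K, A k • w k) ⬝ᵥ (∑ k ∈ K, A k • w k) =
      ∑ k ∈ K, ((‖A k‖ ^ 2 : ℝ) : ℂ) * (star (w k) ⬝ᵥ (w k)) := by
    rw [star_sum, sum_dotProduct]
    refine Finset.sum_congr rfl fun k' hk' => ?_
    rw [dotProduct_sum, Finset.sum_eq_single_of_mem k' hk' fun k hk hne => ?_]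
    · rw [star_smul, smul_dotProduct, dotProduct_smul, smul_smul, smul_eq_mul, Complex.star_def,
        Complex.conj_mul', ← Complex.ofReal_pow]
    · rw [star_smul, smul_dotProduct, dotProduct_smul, hoff k' hk' k hk hne, smul_zero, smul_zero]
  rw [hv, hexp, Complex.re_sum]
  simp_rw [Complex.re_ofReal_mul]
  calc ∑ k ∈ K, ‖A k‖ ^ 2 * (star (w k) ⬝ᵥ (w k)).re
      ≤ ∑ k ∈ K, a * (star ψ ⬝ᵥ ψ).re := Finset.sum_le_sum fun k hk =>
        mul_le_mul (hA k hk) (fom_re_pairMode_mem_Icc m k ψ).2 (fom_re_pairMode_mem_Icc m k ψ).1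
          ((sq_nonneg _).trans (hA k hk))
    _ = a * K.card * (star ψ ⬝ᵥ ψ).re := by
        rw [Finset.sum_const, nsmul_eq_mul]
        ring

end Summit.HubbardSuperconductivity.HubbardSuperconductivity.Theorems.WindowInfraredBound
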